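import Literature.AlgebraicGeometry.Frobenioids.PerfFactorialOrderIso
import HarnessLib

/-!
# Perf-factorial monoids: an order-automorphism fixing the divisors and the multiples of one element
# is the identity

Mochizuki, *The geometry of Frobenioids I: the general theory*, Kyushu J. Math. **62** (2008)
293–400, §2 Def. 2.4 (i) (perf-factorial monoids, kurims pp. 47–48) and §4, proof of Theorem 4.9,
p. 89 ll. 9–17 [cite: MochizukiFrdI2008, Thm. 4.9 p.89]: "if the right-hand and left-hand isomorphisms
of Theorem 4.2, (iii), coincide for all universally Div-Frobenius-trivial objects, then it follows …
from the construction of … `Ψ^Prime` … that `Ψ^Prime` extends, for `A_i ∈ Ob(C_i^bs-iso)` …, to an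
isomorphism of monoids `Φ₁(A₁)^pf_𝔭₁ ≅ Φ₂(A₂)^pf_𝔭₂` which is functorial in `A₁`".

This file supplies the ORDER-THEORETIC RIGIDITY behind that extension step (PROOF ONLY, no new
definitions), in the form in which the tree's direct route to Thm. 4.9 consumes it (the divisor
transport `T_A : Φ₁(A) → Φ₂(ΨA)`, `Div φ ↦ Div Ψφ`, of `DivisorMonoidTransport.lean`): for a PERFECT
perf-factorial monoid `M`, an element `x₀ ∈ M`, and a bijection `r : M → M` with `x ≤ y ↔ r x ≤ r y`
which fixes every primary divisor of `x₀` and every multiple `x₀ · y` of `x₀`, one has `r = id`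
(`IsPerfFactorial.eq_id_of_dvd_iff_of_fix`). Consequently two order-isomorphisms `f, g : M → N`
between perfect perf-factorial monoids which agree on the primary divisors of `x₀` and on the multiples
of `x₀` agree everywhere (`IsPerfFactorial.eq_of_dvd_iff_of_eq_on`). In the proof of Thm. 4.9 this is
applied at an object `W` admitting a pre-step `ψ : W → O` to a universally Div-Frobenius-trivial `O`,
with `x₀ = Div ψ`, `f = T_W` and `g` the conjugate of `T_O` along `ψ` (file
`Thm49RightTransportMultiplicative.lean`).

Ingredients (all from `PerfFactorialOrderIso.lean`, seat abc-iut-w4-d099): order-isomorphisms preserve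
primary elements; the `𝔭`-part / `𝔭`-free splitting of an element (`exists_raySplit`); maximality of
the `𝔭`-part (`dvd_of_ray_of_dvd_mul`); rays are totally ordered
(`precsim_iff_dvd_or_dvd_of_isPrimary`); divisibility is detected by primary divisors
(`dvd_of_forall_isPrimary_dvd'`). Multiplicative notation as in `Monoids.lean`. Nothing here bears on
[IUTchIII].
-/

namespace Literature.AlgebraicGeometry.Frobenioids

open Function

universe u u'

variable {M : Type u} [CommMonoid M]

namespace IsPerfFactorial

/-- **Key step.** For a perfect perf-factorial `M`, `x₀ ∈ M` and an order-automorphism `r` of `M`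
(a bijection with `x ≤ y ↔ r x ≤ r y`) fixing the primary divisors of `x₀` and the multiples of `x₀`:
`r q ≤ q` for every primary `q`. (If `q ∤ x₀`, write `x₀ = x₁·x₂` with `x₁ ≤ q` in the ray of `q`
and `x₂` free of that ray; then `q ∣ x₀·(q/x₁)`, a multiple of `x₀`, so the primary `r q` divides
`q · x₂`; it cannot divide `x₂` — it would be a fixed primary divisor of `x₀`, forcing `q = r q ∣ x₀` —
hence it lies in the ray of `q` and divides `q`.) [cite: MochizukiFrdI2008, Def. 2.4 (i) p.47] -/
theorem map_dvd_self_of_isPrimary_of_fix (hM : IsPerfFactorial M) (hMp : IsPerfect M) (r : M → M)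
    (hr : Bijective r) (hdvd : ∀ x y : M, x ∣ y ↔ r x ∣ r y) (x₀ : M)
    (hfix₁ : ∀ p : M, IsPrimary p → p ∣ x₀ → r p = p) (hfix₂ : ∀ y : M, r (x₀ * y) = x₀ * y)
    {q : M} (hq : IsPrimary q) : r q ∣ q := by
  have hprim := isPrimary_map_iff_of_dvd_iff hM hM hMp hMp r hr hdvd
  by_cases hqx : q ∣ x₀
  · rw [hfix₁ q hq hqx]
  -- split `x₀` at the ray of `q`
  obtain ⟨x₁, x₂, hxs, hx₁, hx₂⟩ := hM.exists_raySplit hMp x₀ hq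
  -- `x₁ ∣ q` (the ray of `q` is totally ordered, and `q ∤ x₀`)
  have hx₁q : x₁ ∣ q := by
    rcases hx₁ with rfl | ⟨hx₁p, hx₁q⟩
    · exact one_dvd q
    · rcases (hM.precsim_iff_dvd_or_dvd_of_isPrimary hx₁p hq).mp hx₁q with h | h
      · exact h
      · exact absurd (h.trans ⟨x₂, hxs.symm⟩) hqx
  obtain ⟨q'', hq''⟩ := hx₁q
  -- `q ∣ x₀ · q''`, a multiple of `x₀` fixed by `r`; hence `r q ∣ q · x₂`
  have hd : r q ∣ q * x₂ := by
    have h1 : q ∣ x₀ * q'' := ⟨x₂, by rw [← hxs, hq'', mul_right_comm]⟩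
    have h2 : x₀ * q'' = q * x₂ := by rw [← hxs, hq'', mul_right_comm]
    rw [← h2, ← hfix₂ q'']
    exact (hdvd _ _).mp h1
  have hrq : IsPrimary (r q) := (hprim q).mpr hq
  by_cases hzq : r q ≼ q
  · -- `r q` lies in the ray of `q`: maximality of the `q`-part of `q · x₂`
    exact hM.dvd_of_ray_of_dvd_mul hMp hq hrq hzq (Or.inr ⟨hq, precsim_refl q⟩) hx₂ hd
  · -- otherwise `r q ∣ x₂ ∣ x₀` is a fixed primary divisor of `x₀`: contradiction
    exfalso
    obtain ⟨s₁, s₂, hss, hs₁, hs₂⟩ := hM.exists_raySplit hMp x₂ hrq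
    have hqfree : ∀ w : M, IsPrimary w → w ≼ r q → ¬ w ∣ q := by
      intro w hw hwz hwq
      have hqw : q ≼ w := hq.2 w hw.1 (Precsim.of_dvd hwq)
      exact hzq (hrq.2 q hq.1 (hqw.trans hwz))
    have hfree : ∀ w : M, IsPrimary w → w ≼ r q → ¬ w ∣ q * s₂ := hM.rayFree_mul hMp hrq hqfree hs₂
    have hd' : r q ∣ s₁ * (q * s₂) := by
      rw [show s₁ * (q * s₂) = q * x₂ by rw [← hss, mul_left_comm]]; exact hd
    have hzs₁ : r q ∣ s₁ := hM.dvd_of_ray_of_dvd_mul hMp hrq hrq (precsim_refl _) hs₁ hfree hd'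
    have hzx₀ : r q ∣ x₀ := hzs₁.trans (⟨s₂, hss.symm⟩ : s₁ ∣ x₂) |>.trans ⟨x₁, by rw [← hxs, mul_comm]⟩
    have hfix := hfix₁ (r q) hrq hzx₀
    exact hqx (hr.1 hfix ▸ hzx₀)

/-- **An order-automorphism of a perfect perf-factorial monoid which fixes the primary divisors of
`x₀` and all multiples of `x₀` is the identity.** [cite: MochizukiFrdI2008, Def. 2.4 (i) p.47] -/
theorem eq_id_of_dvd_iff_of_fix (hM : IsPerfFactorial M) (hMp : IsPerfect M) (r : M → M)
    (hr : Bijective r) (hdvd : ∀ x y : M, x ∣ y ↔ r x ∣ r y) (x₀ : M)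
    (hfix₁ : ∀ p : M, IsPrimary p → p ∣ x₀ → r p = p) (hfix₂ : ∀ y : M, r (x₀ * y) = x₀ * y)
    (y : M) : r y = y := by
  have hMs : IsSharp M := hM.isDivisorial.isSharp
  haveI : IsCancelMul M := isIntegral_iff_isCancelMul.mp hM.isDivisorial.isPreDivisorial.isIntegral
  -- the inverse bijection satisfies the same hypotheses
  let e : M ≃ M := Equiv.ofBijective r hr
  have he : ∀ x, e x = r x := fun _ => rfl
  have hdvd' : ∀ x y : M, x ∣ y ↔ e.symm x ∣ e.symm y := by
    intro x y
    rw [hdvd (e.symm x) (e.symm y), ← he, ← he, e.apply_symm_apply, e.apply_symm_apply]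
  have hfix₁' : ∀ p : M, IsPrimary p → p ∣ x₀ → e.symm p = p := by
    intro p hp hpx
    exact e.injective (by rw [e.apply_symm_apply, he, hfix₁ p hp hpx])
  have hfix₂' : ∀ y : M, e.symm (x₀ * y) = x₀ * y := by
    intro y
    exact e.injective (by rw [e.apply_symm_apply, he, hfix₂ y])
  -- primaries are fixed
  have hprimfix : ∀ q : M, IsPrimary q → r q = q := by
    intro q hq
    refine dvd_antisymm_of_isSharp hMs
      (map_dvd_self_of_isPrimary_of_fix hM hMp r hr hdvd x₀ hfix₁ hfix₂ hq) ?_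
    have h := map_dvd_self_of_isPrimary_of_fix hM hMp e.symm e.symm.bijective hdvd' x₀ hfix₁' hfix₂' hq
    have h' := (hdvd _ _).mp h
    rwa [← he, e.apply_symm_apply] at h'
  -- divisibility is detected by primary divisors
  refine dvd_antisymm_of_isSharp hMs ?_ ?_
  · refine hM.dvd_of_forall_isPrimary_dvd' hMp fun p hp hpy => ?_
    have h := (hdvd' _ _).mp hpy
    have hsp : e.symm p = p := e.injective (by rw [e.apply_symm_apply, he, hprimfix p hp])
    rw [hsp] at h
    have h'' : e.symm (r y) = y := e.injective (by rw [e.apply_symm_apply, he])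
    rwa [h''] at h
  · exact hM.dvd_of_forall_isPrimary_dvd' hMp fun p hp hpy => hprimfix p hp ▸ (hdvd _ _).mp hpy

/-- **Two order-isomorphisms agreeing on the primary divisors and on the multiples of one element
agree.** For perfect perf-factorial `M`, `N`, bijections `f, g : M → N` with `x ≤ y ↔ f x ≤ f y`,
`x ≤ y ↔ g x ≤ g y`, and `x₀ ∈ M` with `f p = g p` for primary `p ∣ x₀` and `f (x₀·y) = g (x₀·y)`
for all `y`: `f = g`. [cite: MochizukiFrdI2008, Thm. 4.9 p.89] -/
theorem eq_of_dvd_iff_of_eq_on {N : Type u'} [CommMonoid N] (hM : IsPerfFactorial M)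
    (hMp : IsPerfect M) (f g : M → N) (hf : Bijective f) (hg : Bijective g)
    (hfd : ∀ x y : M, x ∣ y ↔ f x ∣ f y) (hgd : ∀ x y : M, x ∣ y ↔ g x ∣ g y) (x₀ : M)
    (h₁ : ∀ p : M, IsPrimary p → p ∣ x₀ → f p = g p) (h₂ : ∀ y : M, f (x₀ * y) = g (x₀ * y))
    (y : M) : f y = g y := by
  let eg : M ≃ N := Equiv.ofBijective g hg
  have heg : ∀ x, eg x = g x := fun _ => rfl
  -- `r := g⁻¹ ∘ f` is an order-automorphism of `M` fixing what it should
  let r : M → M := fun x => eg.symm (f x)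
  have hr : Bijective r := eg.symm.bijective.comp hf
  have hrd : ∀ x y : M, x ∣ y ↔ r x ∣ r y := by
    intro x y
    rw [hfd, hgd (r x) (r y)]
    show f x ∣ f y ↔ g (eg.symm (f x)) ∣ g (eg.symm (f y))
    rw [← heg, ← heg, eg.apply_symm_apply, eg.apply_symm_apply]
  have hrfix₁ : ∀ p : M, IsPrimary p → p ∣ x₀ → r p = p := fun p hp hpx =>
    eg.injective (by rw [eg.apply_symm_apply, heg, h₁ p hp hpx])
  have hrfix₂ : ∀ y : M, r (x₀ * y) = x₀ * y := fun y =>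
    eg.injective (by rw [eg.apply_symm_apply, heg, h₂ y])
  have h := eq_id_of_dvd_iff_of_fix hM hMp r hr hrd x₀ hrfix₁ hrfix₂ y
  have h' := congrArg eg h
  rwa [eg.apply_symm_apply, heg] at h'

end IsPerfFactorial

end Literature.AlgebraicGeometry.Frobenioids
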